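import Literature.Probability.LatticeModels.SlidingScaleInfraredBoundProofs
import Literature.Probability.LatticeModels.ImprovedTreeDiagramBoundProofs
import Literature.Probability.LatticeModels.FreeStateGibbs
import Literature.Probability.LatticeModels.CriticalTwoPointBounds
import Literature.Probability.LatticeModels.PointwiseScalingLimitEtaExists
import Summits.CriticalPhenomena.Ising3DConformalLimit.Theorems.HyperoctahedralRPExistsScaleCovariantLimitFoldedCurrentSqrtDoublingBoxSum
import HarnessLib

/-!
# The sliding-scale infrared bound in axis-profile form (crux stmt-CriticalPhenomena-1981, line folded-current-repulsion)

Lead `prover-line-stmt-CriticalPhenomena-1981-c16-0` (crux `ExistsScaleCovariantLimit`), registered sub-goal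
`axis_sliding_profile`. On `ℤ³` at `β_c`, write `g(k) = ⟨σ₀σ_{k e₀}⟩⁺_{β_c} = criticalTwoPoint 3 (Pi.single 0 k)`,
`P(n) = Σ_{k=1}^{n} k² g(k)` (the axis-profile proxy of the box susceptibility) and
`χ_n = Σ_{x ∈ Λ_n} ⟨σ₀σ_x⟩⁺_{β_c}` (`Λ_n = box 3 n`, the sup-norm ball). This file proves

* `axis_sliding_profile` (registered): `∃ K, ∀ 1 ≤ l ≤ L, P(L)/L² ≤ K · P(l)/l²`.

Proof. (1) The sliding-scale infrared bound of Aizenman–Duminil-Copin 2021, Theorem 5.6 — PROVED in the tree,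
`aizenmanDuminilCopin_slidingScaleInfraredBound_holds` — at `β = β_c(3)` for the (unique) critical Gibbs state, whose
two-point function is `criticalTwoPoint 3` (`twoPoint_eq_twoPointFree_of_isingGibbsMeasure`,
`twoPointPlus_criticalBeta_eq_twoPointFree_holds`): `χ_L/L² ≤ K₀ χ_l/l²` (`box_sum_sliding`).
(2) `χ_l ≤ 1 + 54 P(l)` (`box_sum_le_axis_sum`: Messager–Miracle-Solé in the sup norm plus shell counting).
(3) `P(L) ≤ 5 + 75 χ_L`: for `j ∈ {3k, 3k+1, 3k+2}`, `j² g(j) ≤ 25 k² g(3k)` (axis monotonicity), and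
`k² g(3k) ≤ Σ_{‖y‖_∞ = k} ⟨σ₀σ_y⟩` since the sphere has `≥ k²` sites on each of which `⟨σ₀σ_y⟩ ≥ g(3k)`
(`criticalTwoPoint_axis_sandwich`); `P(2) ≤ 5` from `g ≤ 1`.
(4) Assemble, absorbing the additive constants with `P(l) ≥ g(1) > 0`.

References: M. Aizenman, H. Duminil-Copin, Ann. of Math. 194 (2021) = arXiv:1912.07973, Theorem 5.6;
A. Messager, S. Miracle-Solé, J. Stat. Phys. 17 (1977) 245.
-/

noncomputable section

open Finset hiding box
open scoped BigOperators
open Literature.Probability.LatticeModels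

namespace Summit.CriticalPhenomena.Ising3DConformalLimit.Cruxes.ExistsScaleCovariantLimit.FoldedCurrentRepulsion

open Summit.CriticalPhenomena.Ising3DConformalLimit.Cruxes.TwoPointDoubling.Birth (sum_box_succ)

/-! ### (1) The sliding-scale infrared bound at `β_c(3)` for box sums of `criticalTwoPoint 3` -/

/-- **Aizenman–Duminil-Copin 2021, Theorem 5.6 at `β_c` on `ℤ³`, integer scales.** There is `K₀ > 0` with
`χ_L/L² ≤ K₀ χ_l/l²` for all naturals `1 ≤ l ≤ L`, `χ_n = Σ_{x ∈ Λ_n} ⟨σ₀σ_x⟩⁺_{β_c(3)}`: the tree's theorem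
`aizenmanDuminilCopin_slidingScaleInfraredBound_holds` at `β = β_c(3)` for the free critical Gibbs state
(`exists_freeMeasure_holds`), whose two-point function is `criticalTwoPoint 3`.
[cite: AizenmanDuminilCopinAnnals2021, arXiv:1912.07973 Theorem 5.6 (p. 18)] -/
theorem box_sum_sliding : ∃ K₀ : ℝ, 0 < K₀ ∧ ∀ l L : ℕ, 1 ≤ l → l ≤ L →
    (∑ x ∈ box 3 L, criticalTwoPoint 3 x) / (L : ℝ) ^ 2 ≤
      K₀ * ((∑ x ∈ box 3 l, criticalTwoPoint 3 x) / (l : ℝ) ^ 2) := by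
  obtain ⟨C, hC, H⟩ := aizenmanDuminilCopin_slidingScaleInfraredBound_holds (d := 3) le_rfl
  have hβc : 0 < criticalBeta 3 := criticalBeta_pos_holds (d := 3) (by norm_num)
  obtain ⟨μ, hμ, -⟩ := exists_freeMeasure_holds 3 (β := criticalBeta 3) 0 hβc.le le_rfl
  have hS : twoPoint μ spinAt 0 = criticalTwoPoint 3 := by
    funext x
    rw [twoPoint_eq_twoPointFree_of_isingGibbsMeasure le_rfl hβc.le le_rfl hμ x]
    exact (twoPointPlus_criticalBeta_eq_twoPointFree_holds (d := 3) le_rfl x).symm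
  refine ⟨C / criticalBeta 3, div_pos hC hβc, fun l L hl hlL => ?_⟩
  have key := H (criticalBeta 3) l L hβc le_rfl (by exact_mod_cast hl) (by exact_mod_cast hlL) μ hμ
  rw [hS, boxSusceptibility_natCast, boxSusceptibility_natCast] at key
  exact key

/-! ### (3) The axis profile against the box sum -/

/-- On the shell `‖y‖_∞ = k+1` (at least `(k+1)²` sites) the sup-norm Messager–Miracle-Solé sandwich gives
`⟨σ₀σ_y⟩ ≥ g(3(k+1))`, whence `(k+1)² g(3(k+1)) ≤ Σ_{‖y‖_∞ = k+1} ⟨σ₀σ_y⟩`.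
[cite: MessagerMiracleSoleJSP1977, main theorem (monotonicity of ⟨σ₀σ_x⟩ under reflections)] -/
theorem sq_mul_axis_three_le_sum_sphere (k : ℕ) :
    ((k + 1 : ℕ) : ℝ) ^ 2 * criticalTwoPoint 3 (Pi.single 0 ((3 * (k + 1) : ℕ) : ℤ)) ≤
      ∑ x ∈ sphere 3 (k + 1), criticalTwoPoint 3 x := by
  have hB0 : 0 ≤ criticalTwoPoint 3 (Pi.single 0 ((3 * (k + 1) : ℕ) : ℤ)) := criticalTwoPoint_nonneg' _
  have hpt : ∀ x ∈ sphere 3 (k + 1),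
      criticalTwoPoint 3 (Pi.single 0 ((3 * (k + 1) : ℕ) : ℤ)) ≤ criticalTwoPoint 3 x := by
    intro x hx
    have hx' : Site.supNorm x = k + 1 := mem_sphere.1 hx
    have h1 := (criticalTwoPoint_axis_sandwich (y := x) (by omega)).1
    rw [hx'] at h1
    exact h1
  have hcard : ((k + 1 : ℕ) : ℝ) ^ 2 ≤ (#(sphere 3 (k + 1)) : ℝ) := by
    have h := card_sphere_succ_add (d := 3) k
    rw [card_box, card_box] at h
    have h' : (#(sphere 3 (k + 1)) : ℝ) + (2 * k + 1 : ℝ) ^ 3 = (2 * (k + 1) + 1 : ℝ) ^ 3 := by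
      exact_mod_cast h
    have hk : (0 : ℝ) ≤ k := Nat.cast_nonneg k
    push_cast
    nlinarith [sq_nonneg (k : ℝ)]
  calc ((k + 1 : ℕ) : ℝ) ^ 2 * criticalTwoPoint 3 (Pi.single 0 ((3 * (k + 1) : ℕ) : ℤ))
      ≤ (#(sphere 3 (k + 1)) : ℝ) * criticalTwoPoint 3 (Pi.single 0 ((3 * (k + 1) : ℕ) : ℤ)) :=
        mul_le_mul_of_nonneg_right hcard hB0
    _ = ∑ _x ∈ sphere 3 (k + 1), criticalTwoPoint 3 (Pi.single 0 ((3 * (k + 1) : ℕ) : ℤ)) := by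
        rw [sum_const, nsmul_eq_mul]
    _ ≤ ∑ x ∈ sphere 3 (k + 1), criticalTwoPoint 3 x := sum_le_sum hpt

/-- `Σ_{k=1}^{n} k² g(3k) ≤ χ_n`: sum the shell bounds `sq_mul_axis_three_le_sum_sphere` over the disjoint shells
`‖y‖_∞ = k`, `1 ≤ k ≤ n`, of `Λ_n`. [folklore] -/
theorem axis_three_sum_le_box_sum (n : ℕ) :
    ∑ k ∈ Icc 1 n, (k : ℝ) ^ 2 * criticalTwoPoint 3 (Pi.single 0 ((3 * k : ℕ) : ℤ)) ≤
      ∑ x ∈ box 3 n, criticalTwoPoint 3 x := by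
  induction n with
  | zero =>
    rw [Finset.Icc_eq_empty (by norm_num), sum_empty]
    exact sum_nonneg fun x _ => criticalTwoPoint_nonneg' x
  | succ n ih =>
    rw [sum_Icc_succ_top (by omega : 1 ≤ n + 1), sum_box_succ]
    have h := sq_mul_axis_three_le_sum_sphere n
    linarith

/-- `P(3n+2) ≤ 5 + 75 Σ_{k=1}^{n} k² g(3k)`: `P(2) = g(1) + 4 g(2) ≤ 5` (`g ≤ 1`), and for `j ∈ {3k, 3k+1, 3k+2}`,
`j² ≤ 25 k²` and `g(j) ≤ g(3k)` (the axis two-point function is non-increasing). [folklore] -/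
theorem axis_sum_le_axis_three_sum (n : ℕ) :
    ∑ k ∈ Icc 1 (3 * n + 2), (k : ℝ) ^ 2 * criticalTwoPoint 3 (Pi.single 0 (k : ℤ)) ≤
      5 + 75 * ∑ k ∈ Icc 1 n, (k : ℝ) ^ 2 * criticalTwoPoint 3 (Pi.single 0 ((3 * k : ℕ) : ℤ)) := by
  induction n with
  | zero =>
    have hle : ∀ k : ℕ, k ∈ Icc 1 (3 * 0 + 2) →
        (k : ℝ) ^ 2 * criticalTwoPoint 3 (Pi.single 0 (k : ℤ)) ≤ ((k ^ 2 : ℕ) : ℝ) := by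
      intro k _
      push_cast
      exact mul_le_of_le_one_right (sq_nonneg _) (criticalTwoPoint_le_one' _)
    refine (sum_le_sum hle).trans ?_
    rw [← Nat.cast_sum]
    have h5 : (∑ k ∈ Icc 1 (3 * 0 + 2), k ^ 2 : ℕ) = 5 := by decide
    rw [h5]
    simp
  | succ n ih =>
    have e : 3 * (n + 1) + 2 = 3 * n + 2 + 1 + 1 + 1 := by ring
    rw [e, sum_Icc_succ_top (by omega : 1 ≤ 3 * n + 2 + 1 + 1 + 1),
      sum_Icc_succ_top (by omega : 1 ≤ 3 * n + 2 + 1 + 1),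
      sum_Icc_succ_top (by omega : 1 ≤ 3 * n + 2 + 1), sum_Icc_succ_top (by omega : 1 ≤ n + 1)]
    have hG0 : 0 ≤ criticalTwoPoint 3 (Pi.single 0 ((3 * (n + 1) : ℕ) : ℤ)) := criticalTwoPoint_nonneg' _
    have g1 : criticalTwoPoint 3 (Pi.single 0 ((3 * n + 2 + 1 : ℕ) : ℤ)) ≤
        criticalTwoPoint 3 (Pi.single 0 ((3 * (n + 1) : ℕ) : ℤ)) := criticalTwoPoint_axis_antitone (by omega)
    have g2 : criticalTwoPoint 3 (Pi.single 0 ((3 * n + 2 + 1 + 1 : ℕ) : ℤ)) ≤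
        criticalTwoPoint 3 (Pi.single 0 ((3 * (n + 1) : ℕ) : ℤ)) := criticalTwoPoint_axis_antitone (by omega)
    have g3 : criticalTwoPoint 3 (Pi.single 0 ((3 * n + 2 + 1 + 1 + 1 : ℕ) : ℤ)) ≤
        criticalTwoPoint 3 (Pi.single 0 ((3 * (n + 1) : ℕ) : ℤ)) := criticalTwoPoint_axis_antitone (by omega)
    have hn0 : (0 : ℝ) ≤ n := Nat.cast_nonneg n
    have s1 : ((3 * n + 2 + 1 : ℕ) : ℝ) ^ 2 ≤ 9 * ((n + 1 : ℕ) : ℝ) ^ 2 := by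
      push_cast; nlinarith [sq_nonneg (n : ℝ)]
    have s2 : ((3 * n + 2 + 1 + 1 : ℕ) : ℝ) ^ 2 ≤ 16 * ((n + 1 : ℕ) : ℝ) ^ 2 := by
      push_cast; nlinarith [sq_nonneg (n : ℝ)]
    have s3 : ((3 * n + 2 + 1 + 1 + 1 : ℕ) : ℝ) ^ 2 ≤ 25 * ((n + 1 : ℕ) : ℝ) ^ 2 := by
      push_cast; nlinarith [sq_nonneg (n : ℝ)]
    have t1 := mul_le_mul s1 g1 (criticalTwoPoint_nonneg' _) (by positivity)
    have t2 := mul_le_mul s2 g2 (criticalTwoPoint_nonneg' _) (by positivity)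
    have t3 := mul_le_mul s3 g3 (criticalTwoPoint_nonneg' _) (by positivity)
    have hsq : (0 : ℝ) ≤ ((n + 1 : ℕ) : ℝ) ^ 2 := sq_nonneg _
    nlinarith [t1, t2, t3, ih, mul_nonneg hsq hG0]

/-- **The axis profile against the box susceptibility**: `P(L) ≤ 5 + 75 χ_L` for every `L`
(`P` is non-decreasing, `L ≤ 3⌊L/3⌋ + 2`, `axis_sum_le_axis_three_sum`, `axis_three_sum_le_box_sum`, `Λ_{⌊L/3⌋} ⊆ Λ_L`).
[cite: MessagerMiracleSoleJSP1977, main theorem (monotonicity of ⟨σ₀σ_x⟩ under reflections)] -/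
theorem axis_sum_le_box_sum (L : ℕ) :
    ∑ k ∈ Icc 1 L, (k : ℝ) ^ 2 * criticalTwoPoint 3 (Pi.single 0 (k : ℤ)) ≤
      5 + 75 * ∑ x ∈ box 3 L, criticalTwoPoint 3 x := by
  have hmono : ∑ k ∈ Icc 1 L, (k : ℝ) ^ 2 * criticalTwoPoint 3 (Pi.single 0 (k : ℤ)) ≤
      ∑ k ∈ Icc 1 (3 * (L / 3) + 2), (k : ℝ) ^ 2 * criticalTwoPoint 3 (Pi.single 0 (k : ℤ)) := by
    refine sum_le_sum_of_subset_of_nonneg (Icc_subset_Icc le_rfl (by omega)) fun k _ _ => ?_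
    exact mul_nonneg (sq_nonneg _) (criticalTwoPoint_nonneg' _)
  have hbox : ∑ x ∈ box 3 (L / 3), criticalTwoPoint 3 x ≤ ∑ x ∈ box 3 L, criticalTwoPoint 3 x :=
    sum_le_sum_of_subset_of_nonneg (box_mono 3 (Nat.div_le_self L 3)) fun x _ _ => criticalTwoPoint_nonneg' x
  linarith [axis_sum_le_axis_three_sum (L / 3), axis_three_sum_le_box_sum (L / 3)]

/-! ### (4) The registered sub-goal -/

/-- **The sliding-scale infrared bound in axis-profile form** (registered sub-goal `axis_sliding_profile` of line
`folded-current-repulsion`, crux stmt-CriticalPhenomena-1981). With `g(k) = ⟨σ₀σ_{k e₀}⟩⁺_{β_c(3)}` and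
`P(n) = Σ_{k=1}^{n} k² g(k)`: `∃ K, ∀ 1 ≤ l ≤ L, P(L)/L² ≤ K · P(l)/l²`. From Aizenman–Duminil-Copin 2021, Theorem 5.6
(`χ_L/L² ≤ K₀ χ_l/l²`, proved in the tree) and the two-sided comparison `χ_l ≤ 1 + 54 P(l)`, `P(L) ≤ 5 + 75 χ_L`
(Messager–Miracle-Solé in the sup norm), the additive constants being absorbed by `P(l) ≥ g(1) > 0`; the constant is
`K = 5/g(1) + 75 K₀ (1/g(1) + 54)`. [cite: AizenmanDuminilCopinAnnals2021, arXiv:1912.07973 Theorem 5.6 (p. 18)] -/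
theorem axis_sliding_profile : ∃ K : ℝ, ∀ l L : ℕ, 1 ≤ l → l ≤ L → (∑ k ∈ Finset.Icc 1 L, (k : ℝ) ^ 2 * Literature.Probability.LatticeModels.criticalTwoPoint 3 (Pi.single 0 (k : ℤ))) / (L : ℝ) ^ 2 ≤ K * ((∑ k ∈ Finset.Icc 1 l, (k : ℝ) ^ 2 * Literature.Probability.LatticeModels.criticalTwoPoint 3 (Pi.single 0 (k : ℤ))) / (l : ℝ) ^ 2) := by
  obtain ⟨K₀, hK₀, hslide⟩ := box_sum_sliding
  set g1 : ℝ := criticalTwoPoint 3 (Pi.single 0 ((1 : ℕ) : ℤ)) with hg1_def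
  have hg1 : 0 < g1 := criticalTwoPoint_axis_pos 1
  refine ⟨5 / g1 + 75 * K₀ * (1 / g1 + 54), fun l L hl hlL => ?_⟩
  set p : ℝ := ∑ k ∈ Icc 1 l, (k : ℝ) ^ 2 * criticalTwoPoint 3 (Pi.single 0 (k : ℤ)) with hp
  set q : ℝ := ∑ k ∈ Icc 1 L, (k : ℝ) ^ 2 * criticalTwoPoint 3 (Pi.single 0 (k : ℤ)) with hq
  set χl : ℝ := ∑ x ∈ box 3 l, criticalTwoPoint 3 x with hχl
  set χL : ℝ := ∑ x ∈ box 3 L, criticalTwoPoint 3 x with hχL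
  have hx : (0 : ℝ) < (l : ℝ) ^ 2 := by
    have : (0 : ℝ) < l := by exact_mod_cast hl
    positivity
  have hy : (0 : ℝ) < (L : ℝ) ^ 2 := by
    have : (0 : ℝ) < L := by exact_mod_cast (show 0 < L by omega)
    positivity
  have hxy : (l : ℝ) ^ 2 ≤ (L : ℝ) ^ 2 := by
    have : (l : ℝ) ≤ L := by exact_mod_cast hlL
    gcongr
  -- (1) sliding-scale infrared bound, division-free
  have hb : χL * (l : ℝ) ^ 2 ≤ K₀ * χl * (L : ℝ) ^ 2 := by
    have h := hslide l L hl hlL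
    rw [div_le_iff₀ hy] at h
    have hl0 : (0 : ℝ) ≤ (l : ℝ) ^ 2 := hx.le
    calc χL * (l : ℝ) ^ 2 ≤ K₀ * (χl / (l : ℝ) ^ 2) * (L : ℝ) ^ 2 * (l : ℝ) ^ 2 :=
          mul_le_mul_of_nonneg_right h hl0
      _ = K₀ * χl * (L : ℝ) ^ 2 := by field_simp
  -- (2) `χ_l ≤ 1 + 54 P(l)`
  have hc : χl ≤ 1 + 54 * p := by
    have h := box_sum_le_axis_sum l
    have e : ∑ k ∈ Icc 1 l, 54 * (k : ℝ) ^ 2 * criticalTwoPoint 3 (Pi.single 0 (k : ℤ)) = 54 * p := by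
      rw [hp, Finset.mul_sum]
      exact sum_congr rfl fun k _ => by ring
    linarith
  -- (3) `P(L) ≤ 5 + 75 χ_L`
  have ha : q ≤ 5 + 75 * χL := axis_sum_le_box_sum L
  -- `P(l) ≥ g(1) > 0`
  have hd : g1 ≤ p := by
    have h1 : ∑ k ∈ Icc (1 : ℕ) 1, (k : ℝ) ^ 2 * criticalTwoPoint 3 (Pi.single 0 (k : ℤ)) = g1 := by
      rw [Finset.Icc_self, sum_singleton, hg1_def]; simp
    rw [← h1, hp]
    refine sum_le_sum_of_subset_of_nonneg (Icc_subset_Icc le_rfl hl) fun k _ _ => ?_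
    exact mul_nonneg (sq_nonneg _) (criticalTwoPoint_nonneg' _)
  have h1p : 1 ≤ p / g1 := by rw [le_div_iff₀ hg1]; linarith
  have hp0 : 0 ≤ p := hg1.le.trans hd
  -- (4) assemble
  rw [div_le_iff₀ hy, show (5 / g1 + 75 * K₀ * (1 / g1 + 54)) * (p / (l : ℝ) ^ 2) * (L : ℝ) ^ 2 =
    (5 / g1 + 75 * K₀ * (1 / g1 + 54)) * p * (L : ℝ) ^ 2 / (l : ℝ) ^ 2 by ring, le_div_iff₀ hx]
  calc q * (l : ℝ) ^ 2 ≤ (5 + 75 * χL) * (l : ℝ) ^ 2 := mul_le_mul_of_nonneg_right ha hx.le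
    _ = 5 * (l : ℝ) ^ 2 + 75 * (χL * (l : ℝ) ^ 2) := by ring
    _ ≤ 5 * (L : ℝ) ^ 2 + 75 * (K₀ * χl * (L : ℝ) ^ 2) := by linarith
    _ ≤ 5 * (L : ℝ) ^ 2 + 75 * (K₀ * (1 + 54 * p) * (L : ℝ) ^ 2) := by gcongr
    _ ≤ 5 * (L : ℝ) ^ 2 * (p / g1) + 75 * (K₀ * (p / g1 + 54 * p) * (L : ℝ) ^ 2) := by
        have h5 : 5 * (L : ℝ) ^ 2 ≤ 5 * (L : ℝ) ^ 2 * (p / g1) := le_mul_of_one_le_right (by positivity) h1p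
        have h6 : K₀ * (1 + 54 * p) * (L : ℝ) ^ 2 ≤ K₀ * (p / g1 + 54 * p) * (L : ℝ) ^ 2 := by gcongr
        linarith
    _ = (5 / g1 + 75 * K₀ * (1 / g1 + 54)) * p * (L : ℝ) ^ 2 := by ring

end Summit.CriticalPhenomena.Ising3DConformalLimit.Cruxes.ExistsScaleCovariantLimit.FoldedCurrentRepulsion

end
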